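import Literature.Probability.RandomPlanarGeometry.WholePlaneLoewnerGluing
import Literature.Probability.RandomPlanarGeometry.RadialLoewnerSymmetry
import Literature.Probability.RandomPlanarGeometry.RadialLoewnerDiscMaps
import HarnessLib

/-!
# A whole-plane curve piece from the local radial generation of the increment driver

Topic `Probability/RandomPlanarGeometry`; one definition with body (`WholePlaneLoewnerChain.pieceCurve`)
and proved theorems (no named fact). Sequel of `WholePlaneLoewnerGluing` and
`WholePlaneLoewnerMarkov`. From the base time `b`, the interior coordinate `1/g_b` turns the
whole-plane chain of the angle `λ` into the radial chain in `𝔻` of the shifted driver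
`u ↦ -λ(b + u)` (`WholePlaneLoewnerChain.compl_hull_add_eq`, `map_add_eq`). The radial theory of a
random driving function is applied to the **increment** `V_b(u) = λ(b + u) - λ(b)` (a functional of
the stationary angle path whose law is comparable to Brownian motion); the shifted driver is its
reflection rotated by `e^{-iλ_b}`: `-λ(b + u) = -V_b(u) - λ_b`. This file transports a local
generation statement for `V_b` — a continuous `η : ℝ≥0 → ℂ`, `|η| ≤ 1`, `|η_u| < 1` for `u > 0`,
with `D_u(V_b) =` the component of `0` in `𝔻 ∖ η[0, u]` and the tips
`g_u⁻¹(r e^{iV_b(u)}) → η_u` (`RadialSLE.LocallyGeneratedSimple`) — to the whole plane: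

* `RadialLoewner.Disc.map_reflect_rotate`, `invFunOn_map_reflect_rotate` — the radial maps under
  `w ↦ e^{ic} w̄` (from `IsSolution.conj`, `IsSolution.rotate`);
* `WholePlaneLoewnerChain.pieceCurve` — the candidate whole-plane curve
  `γ_b(s) = F_b(1 / (e^{-iλ_b} conj η(s - b)))` on `(b, b + u₂]`, which avoids `K_b`
  (`pieceCurve_notMem_hull`), is continuous (`continuousOn_pieceCurve`), satisfies the radial domain
  identity in the form of `isCurve_of_local_pieces` (`domain_shiftDriver_eq_component`), and **is
  the whole-plane tip**: `F_s(R e^{iλ_s}) → γ_b(s)` as `R ↓ 1` (`tendsto_invMap_pieceCurve`) — so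
  the pieces from different base times agree.

## References

* J. Miller, S. Sheffield, *Imaginary geometry IV*, PTRF 169 (2017), arXiv:1302.4738, §2.1.3 and
  Prop. 2.5 (proof). [MillerSheffield2013]
* G. F. Lawler, *Conformally Invariant Processes in the Plane*, AMS (2005), §4.2, Remark 4.22,
  §6.5–6.6. [Lawler2005]
-/

noncomputable section

open Set Filter Topology Metric Complex
open scoped NNReal ComplexConjugate

namespace Literature.Probability.RandomPlanarGeometry

/-! ### Radial maps under reflection-rotation -/

namespace RadialLoewner.Disc

variable {V : ℝ≥0 → ℝ}

/-- The reflected-rotated driver is continuous. [folklore] -/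
theorem continuous_reflect_rotate (hV : Continuous V) (c : ℝ) : Continuous fun u ↦ -V u + c :=
  hV.neg.add continuous_const

/-- **The radial Loewner maps under `w ↦ e^{ic} w̄`**: the chain of the driver `u ↦ -V(u) + c` at a
point of its domain is the reflected-rotated chain of `V`. [cite: Lawler2005, §4.2] -/
theorem map_reflect_rotate (hV : Continuous V) (c : ℝ) {u : ℝ≥0} {w : ℂ} (hw : w ∈ domain V u) :
    map (fun v ↦ -V v + c) u (Complex.exp (c * Complex.I) * conj w) =
      Complex.exp (c * Complex.I) * conj (map V u w) := by
  obtain ⟨g, hg⟩ := exists_isSolution_swallowingTime hV w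
  have hu : (u : WithTop ℝ≥0) < swallowingTime V w := ((mem_domain_iff V u w).1 hw).2
  have h1 := (hg.conj).rotate c
  rw [map_eq_of_isSolution (continuous_reflect_rotate hV c) h1 hu, map_eq_of_isSolution hV hg hu]

/-- The domains under `w ↦ e^{ic} w̄`. [cite: Lawler2005, §4.2] -/
theorem mem_domain_reflect_rotate (c : ℝ) {u : ℝ≥0} {w : ℂ} (hw : w ∈ domain V u) :
    Complex.exp (c * Complex.I) * conj w ∈ domain (fun v ↦ -V v + c) u := by
  rw [show (fun v ↦ -V v + c) = fun v ↦ (fun v ↦ -V v) v + c from rfl, domain_rotate, domain_conj]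
  exact ⟨conj w, ⟨w, hw, rfl⟩, rfl⟩

/-- **The inverse radial maps under `w ↦ e^{ic} w̄`.** [cite: Lawler2005, §4.2] -/
theorem invFunOn_map_reflect_rotate (hV : Continuous V) (c : ℝ) (u : ℝ≥0) {y : ℂ} (hy : y ∈ ball (0 : ℂ) 1) :
    Function.invFunOn (map (fun v ↦ -V v + c) u) (domain (fun v ↦ -V v + c) u)
        (Complex.exp (c * Complex.I) * conj y) =
      Complex.exp (c * Complex.I) * conj (Function.invFunOn (map V u) (domain V u) y) := by
  have hbij := bijOn_map hV u
  have hbij' := bijOn_map (continuous_reflect_rotate hV c) u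
  set x := Function.invFunOn (map V u) (domain V u) y with hx
  have hex : ∃ a ∈ domain V u, map V u a = y := hbij.surjOn hy
  have hx1 : x ∈ domain V u := Function.invFunOn_mem hex
  have hx2 : map V u x = y := Function.invFunOn_eq hex
  have hy' : Complex.exp (c * Complex.I) * conj y ∈ ball (0 : ℂ) 1 := by
    rw [mem_ball_zero_iff, norm_mul, Complex.norm_exp_ofReal_mul_I, one_mul, Complex.norm_conj]
    exact mem_ball_zero_iff.1 hy
  set x' := Function.invFunOn (map (fun v ↦ -V v + c) u) (domain (fun v ↦ -V v + c) u)
    (Complex.exp (c * Complex.I) * conj y) with hx'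
  have hex' : ∃ a ∈ domain (fun v ↦ -V v + c) u, map (fun v ↦ -V v + c) u a = Complex.exp (c * Complex.I) * conj y :=
    hbij'.surjOn hy'
  have hx'1 : x' ∈ domain (fun v ↦ -V v + c) u := Function.invFunOn_mem hex'
  have hx'2 : map (fun v ↦ -V v + c) u x' = Complex.exp (c * Complex.I) * conj y := Function.invFunOn_eq hex'
  have hT : Complex.exp (c * Complex.I) * conj x ∈ domain (fun v ↦ -V v + c) u := mem_domain_reflect_rotate c hx1
  refine hbij'.injOn hx'1 hT ?_
  rw [hx'2, map_reflect_rotate hV c hx1, hx2]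

end RadialLoewner.Disc

/-! ### The piece -/

namespace WholePlaneLoewnerChain

variable {lam : ℝ → ℝ}

/-- The increment driver from the base time `b`: `V_b(u) = λ(b + u) - λ(b)`. [folklore] -/
def incr (lam : ℝ → ℝ) (b : ℝ) : ℝ≥0 → ℝ := fun u ↦ lam (b + u) - lam b

/-- The shifted driver is the reflected increment rotated by `-λ_b`. [folklore] -/
theorem shiftDriver_eq_incr (lam : ℝ → ℝ) (b : ℝ) :
    WholePlaneLoewner.shiftDriver lam b = fun u ↦ -incr lam b u + -lam b := by
  funext u; simp only [WholePlaneLoewner.shiftDriver, incr]; ring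

/-- The reflection-rotation of the disc carrying the increment picture to the interior picture:
`T w = e^{-iλ_b} w̄`. [folklore] -/
def reflRot (lam : ℝ → ℝ) (b : ℝ) (w : ℂ) : ℂ := Complex.exp ((-lam b : ℝ) * Complex.I) * conj w

/-- `T` preserves norms. [folklore] -/
theorem norm_reflRot (lam : ℝ → ℝ) (b : ℝ) (w : ℂ) : ‖reflRot lam b w‖ = ‖w‖ := by
  rw [reflRot, norm_mul, Complex.norm_exp_ofReal_mul_I, one_mul, Complex.norm_conj]

/-- `T` is continuous. [folklore] -/
theorem continuous_reflRot (lam : ℝ → ℝ) (b : ℝ) : Continuous (reflRot lam b) :=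
  continuous_const.mul Complex.continuous_conj

/-- `T` carries the approach points of the increment picture to those of the interior picture:
`T(r e^{iV_b(u)}) = r e^{-iλ(b+u)}`. [folklore] -/
theorem reflRot_approach (lam : ℝ → ℝ) (b : ℝ) (r : ℝ) (u : ℝ≥0) :
    reflRot lam b ((r : ℂ) * Complex.exp ((incr lam b u : ℝ) * Complex.I)) =
      (r : ℂ) * Complex.exp ((-lam (b + u) : ℝ) * Complex.I) := by
  rw [reflRot, map_mul, Complex.conj_ofReal, ← Complex.exp_conj, map_mul, Complex.conj_ofReal,
    Complex.conj_I, incr]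
  rw [mul_left_comm, ← Complex.exp_add]
  congr 2
  push_cast
  ring

/-- **The candidate whole-plane curve of the piece**: `γ_b(s) = F_b(1 / T(η(s - b)))`, the point
outside `K_b` whose interior coordinate is `T(η(s - b))`. [cite: MillerSheffield2013, Prop. 2.5 (proof)] -/
def pieceCurve (lam : ℝ → ℝ) (b : ℝ) (η : ℝ≥0 → ℂ) (s : ℝ) : ℂ :=
  WholePlaneLoewner.BackwardFlow.invMap lam b (reflRot lam b (η (s - b).toNNReal))⁻¹

section Piece

variable {b : ℝ} {u₂ : ℝ≥0} {η : ℝ≥0 → ℂ}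

/-- The inverse interior coordinate `w ↦ F_b(1/w)` lands outside `K_b`. [folklore] -/
theorem invMap_inv_notMem_hull (C : WholePlaneLoewnerChain lam) (hlam : Continuous lam) {w : ℂ} (hw0 : w ≠ 0) (hw1 : ‖w‖ < 1) :
    WholePlaneLoewner.BackwardFlow.invMap lam b w⁻¹ ∉ C.hull b :=
  (C.exists_invCoord_eq hlam hw0 hw1).1

/-- Its interior coordinate is `w`. [folklore] -/
theorem invCoord_invMap_inv (C : WholePlaneLoewnerChain lam) (hlam : Continuous lam) {w : ℂ} (hw0 : w ≠ 0) (hw1 : ‖w‖ < 1) :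
    (C.map b (WholePlaneLoewner.BackwardFlow.invMap lam b w⁻¹))⁻¹ = w :=
  (C.exists_invCoord_eq hlam hw0 hw1).2

/-- `w ↦ F_b(1/w)` is continuous on the punctured open disc. [folklore] -/
theorem continuousOn_invMap_inv (hlam : Continuous lam) :
    ContinuousOn (fun w ↦ WholePlaneLoewner.BackwardFlow.invMap lam b w⁻¹) (ball (0 : ℂ) 1 \ {0}) := by
  refine (WholePlaneLoewner.BackwardFlow.continuousOn_invMap hlam b).comp (continuousOn_inv₀.mono fun w hw ↦ hw.2)
    fun w hw ↦ ?_
  show 1 < ‖w⁻¹‖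
  rw [norm_inv]
  exact (one_lt_inv₀ (norm_pos_iff.2 hw.2)).2 (mem_ball_zero_iff.1 hw.1)

/-- Tips are nonzero: `η_u ≠ 0` (the origin lies in the radial domain, which avoids `η[0, u]`).
[folklore] -/
theorem eta_ne_zero (hG : ∀ u : ℝ≥0, u ≤ u₂ → RadialLoewner.Disc.domain (incr lam b) u =
      connectedComponentIn (ball (0 : ℂ) 1 \ η '' Icc 0 u) 0) {u : ℝ≥0} (hu : u ≤ u₂) : η u ≠ 0 := by
  intro h0
  have h := RadialLoewner.Disc.zero_mem_domain (incr lam b) u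
  rw [hG u hu] at h
  exact (connectedComponentIn_subset _ _ h).2 ⟨u, ⟨bot_le, le_rfl⟩, h0⟩

section WithEta

variable (hηlt : ∀ s : ℝ≥0, 0 < s → ‖η s‖ < 1)
  (hG : ∀ u : ℝ≥0, u ≤ u₂ → RadialLoewner.Disc.domain (incr lam b) u =
    connectedComponentIn (ball (0 : ℂ) 1 \ η '' Icc 0 u) 0)
include hηlt hG

/-- The interior coordinate `T(η(s - b))` of the piece point is in the punctured open disc
(`b < s ≤ b + u₂`). [folklore] -/
theorem reflRot_eta_mem {s : ℝ} (hs : s ∈ Ioc b (b + u₂)) :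
    reflRot lam b (η (s - b).toNNReal) ∈ ball (0 : ℂ) 1 \ {0} := by
  have hpos : (0 : ℝ≥0) < (s - b).toNNReal := Real.toNNReal_pos.2 (by linarith [hs.1])
  have hle : (s - b).toNNReal ≤ u₂ := Real.toNNReal_le_iff_le_coe.2 (by linarith [hs.2])
  refine ⟨mem_ball_zero_iff.2 ?_, ?_⟩
  · rw [norm_reflRot]; exact hηlt _ hpos
  · rw [mem_singleton_iff, reflRot, mul_eq_zero, not_or]
    exact ⟨Complex.exp_ne_zero _, fun h ↦ eta_ne_zero hG hle ((map_eq_zero _).1 h)⟩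

/-- **The piece avoids `K_b`.** [cite: MillerSheffield2013, Prop. 2.5 (proof)] -/
theorem pieceCurve_notMem_hull (C : WholePlaneLoewnerChain lam) (hlam : Continuous lam) {s : ℝ} (hs : s ∈ Ioc b (b + u₂)) :
    pieceCurve lam b η s ∉ C.hull b := by
  obtain ⟨h1, h0⟩ := reflRot_eta_mem hηlt hG hs
  exact C.invMap_inv_notMem_hull hlam h0 (mem_ball_zero_iff.1 h1)

/-- **The interior coordinate of the piece is `T ∘ η`.** [folklore] -/
theorem invCoord_pieceCurve (C : WholePlaneLoewnerChain lam) (hlam : Continuous lam) {s : ℝ} (hs : s ∈ Ioc b (b + u₂)) :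
    (C.map b (pieceCurve lam b η s))⁻¹ = reflRot lam b (η (s - b).toNNReal) := by
  obtain ⟨h1, h0⟩ := reflRot_eta_mem hηlt hG hs
  exact C.invCoord_invMap_inv hlam h0 (mem_ball_zero_iff.1 h1)

/-- **The piece is continuous** on `(b, b + u₂]`. [folklore] -/
theorem continuousOn_pieceCurve (hlam : Continuous lam) (hηc : Continuous η) :
    ContinuousOn (pieceCurve lam b η) (Ioc b (b + u₂)) := by
  refine (continuousOn_invMap_inv hlam).comp
    (((continuous_reflRot lam b).comp (hηc.comp (continuous_real_toNNReal.comp (continuous_sub_right b)))).continuousOn)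
    fun s hs ↦ reflRot_eta_mem hηlt hG hs

/-- **The radial domain identity of the interior picture, with the piece**: for `0 < u ≤ u₂`,
`D_u(-λ(b + ·))` is the component of `0` in `𝔻 ∖ (1/g_b ∘ γ_b)((b, b + u])`
(the hypothesis of `isCurve_of_local_pieces`). [cite: MillerSheffield2013, Prop. 2.5 (proof)] -/
theorem domain_shiftDriver_eq_component (C : WholePlaneLoewnerChain lam) (hlam : Continuous lam) (hη0 : ‖η 0‖ = 1)
    {u : ℝ≥0} (hu : u ≤ u₂) :
    RadialLoewner.Disc.domain (WholePlaneLoewner.shiftDriver lam b) u =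
      connectedComponentIn (ball (0 : ℂ) 1 \ (fun s ↦ (C.map b (pieceCurve lam b η s))⁻¹) '' Ioc b (b + u)) 0 := by
  have h1 := RadialLoewner.Disc.domain_eq_component_conj (hG u hu)
  have h2 := RadialLoewner.Disc.domain_eq_component_rotate h1 (-lam b)
  rw [shiftDriver_eq_incr, show (fun u ↦ -incr lam b u + -lam b) = fun v ↦ (fun v ↦ -incr lam b v) v + (-lam b) from rfl, h2]
  congr 1
  -- `𝔻 ∖ T(η[0,u]) = 𝔻 ∖ (1/g_b ∘ γ_b)((b, b+u])`
  ext w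
  simp only [Set.mem_sdiff, mem_image, mem_Icc, mem_Ioc, and_congr_right_iff]
  intro hw
  refine not_congr ⟨?_, ?_⟩
  · rintro ⟨v, ⟨hv0, hvu⟩, rfl⟩
    rcases hv0.eq_or_lt with rfl | hvpos
    · exfalso
      have : ‖Complex.exp (((-lam b : ℝ) : ℂ) * Complex.I) * (starRingEnd ℂ) (η 0)‖ = 1 := by
        rw [show Complex.exp (((-lam b : ℝ) : ℂ) * Complex.I) * (starRingEnd ℂ) (η 0) = reflRot lam b (η 0) from rfl,
          norm_reflRot, hη0]
      exact absurd (mem_ball_zero_iff.1 hw) (by rw [this]; exact lt_irrefl 1)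
    · refine ⟨b + v, ⟨by simpa using hvpos, by simpa using hvu⟩, ?_⟩
      rw [invCoord_pieceCurve hηlt hG C hlam ⟨by simpa using hvpos, by
        have := NNReal.coe_le_coe.2 (hvu.trans hu); linarith⟩]
      simp [reflRot]
  · rintro ⟨s, ⟨hbs, hsu⟩, hsw⟩
    have hs2 : s ∈ Ioc b (b + u₂) := ⟨hbs, hsu.trans (by have := NNReal.coe_le_coe.2 hu; linarith)⟩
    rw [invCoord_pieceCurve hηlt hG C hlam hs2] at hsw
    refine ⟨(s - b).toNNReal, ⟨bot_le, Real.toNNReal_le_iff_le_coe.2 (by linarith)⟩, ?_⟩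
    rw [← hsw]; rfl

/-- **The piece is the whole-plane tip**: for `b < s ≤ b + u₂`,
`F_s(R e^{iλ_s}) → γ_b(s)` as `R ↓ 1`, granted the radial tips of the increment picture
`g_u⁻¹(r e^{iV_b(u)}) → η_u` (`r ↑ 1`). Hence pieces from different base times agree. Proof: by
the radial Markov property (`map_add_eq`, `compl_hull_add_eq`) `F_s(R e^{iλ_s})` is the point
outside `K_b` with interior coordinate `g_u⁻¹(R⁻¹ e^{-iλ_s})` for the shifted driver, which is
`T` of the increment's `g_u⁻¹(R⁻¹ e^{iV_b(u)})` (`invFunOn_map_reflect_rotate`), and `w ↦ F_b(1/w)`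
is continuous at `T(η_u)`. [cite: MillerSheffield2013, Prop. 2.5 (proof)] -/
theorem tendsto_invMap_pieceCurve (hlam : Continuous lam)
    (htip : ∀ u : ℝ≥0, u ≤ u₂ → Tendsto (fun r : ℝ ↦ Function.invFunOn (RadialLoewner.Disc.map (incr lam b) u)
      (RadialLoewner.Disc.domain (incr lam b) u) ((r : ℂ) * Complex.exp ((incr lam b u : ℝ) * Complex.I)))
      (𝓝[<] 1) (𝓝 (η u)))
    {s : ℝ} (hs : s ∈ Ioc b (b + u₂)) :
    Tendsto (fun R : ℝ ↦ WholePlaneLoewner.BackwardFlow.invMap lam s ((R : ℂ) * Complex.exp ((lam s : ℝ) * Complex.I)))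
      (𝓝[>] 1) (𝓝 (pieceCurve lam b η s)) := by
  set u : ℝ≥0 := (s - b).toNNReal with hudef
  have hu0 : (0 : ℝ) < s - b := by linarith [hs.1]
  have hucoe : (u : ℝ) = s - b := Real.coe_toNNReal _ hu0.le
  have hbu : b + u = s := by rw [hucoe]; ring
  have hule : u ≤ u₂ := Real.toNNReal_le_iff_le_coe.2 (by linarith [hs.2])
  obtain ⟨⟨C⟩, -⟩ := WholePlaneLoewnerChain.exists_unique_holds lam hlam
  have hVc : Continuous (incr lam b) := (hlam.comp (continuous_const.add NNReal.continuous_coe)).sub continuous_const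
  set V := incr lam b with hVdef
  set Φ : ℂ → ℂ := fun w ↦ WholePlaneLoewner.BackwardFlow.invMap lam b w⁻¹ with hΦ
  set x : ℝ → ℂ := fun r ↦ Function.invFunOn (RadialLoewner.Disc.map V u) (RadialLoewner.Disc.domain V u)
    ((r : ℂ) * Complex.exp ((V u : ℝ) * Complex.I)) with hx
  -- the identity `F_s(R e^{iλ s}) = Φ (T (x R⁻¹))` for `R > 1`
  have key : ∀ R : ℝ, 1 < R →
      WholePlaneLoewner.BackwardFlow.invMap lam s ((R : ℂ) * Complex.exp ((lam s : ℝ) * Complex.I)) =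
        Φ (reflRot lam b (x R⁻¹)) := by
    intro R hR
    have hR0 : 0 < R := zero_lt_one.trans hR
    have hr1 : R⁻¹ < 1 := inv_lt_one_of_one_lt₀ hR
    have hr0 : 0 < R⁻¹ := inv_pos.2 hR0
    -- the increment-picture point and its preimage
    have hy : ((R⁻¹ : ℝ) : ℂ) * Complex.exp ((V u : ℝ) * Complex.I) ∈ ball (0 : ℂ) 1 := by
      rw [mem_ball_zero_iff, norm_mul, Complex.norm_exp_ofReal_mul_I, mul_one, Complex.norm_real,
        Real.norm_eq_abs, abs_of_pos hr0]
      exact hr1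
    have hbij := RadialLoewner.Disc.bijOn_map hVc u
    have hex : ∃ a ∈ RadialLoewner.Disc.domain V u,
        RadialLoewner.Disc.map V u a = ((R⁻¹ : ℝ) : ℂ) * Complex.exp ((V u : ℝ) * Complex.I) := hbij.surjOn hy
    have hx1 : x R⁻¹ ∈ RadialLoewner.Disc.domain V u := Function.invFunOn_mem hex
    have hx2 : RadialLoewner.Disc.map V u (x R⁻¹) = ((R⁻¹ : ℝ) : ℂ) * Complex.exp ((V u : ℝ) * Complex.I) :=
      Function.invFunOn_eq hex
    -- the interior coordinate `w = T (x R⁻¹)` lies in the radial domain of the shifted driver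
    set w := reflRot lam b (x R⁻¹) with hw
    have hw1 : w ∈ RadialLoewner.Disc.domain (WholePlaneLoewner.shiftDriver lam b) u := by
      rw [shiftDriver_eq_incr]
      exact RadialLoewner.Disc.mem_domain_reflect_rotate (-lam b) hx1
    have hwball : ‖w‖ < 1 := mem_ball_zero_iff.1 (RadialLoewner.Disc.domain_subset _ _ hw1)
    have hw0 : w ≠ 0 := by
      intro h0
      have : RadialLoewner.Disc.map (WholePlaneLoewner.shiftDriver lam b) u w = 0 := by
        rw [h0]; exact RadialLoewner.Disc.map_zero (WholePlaneLoewner.continuous_shiftDriver hlam b) u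
      rw [hw, shiftDriver_eq_incr, reflRot, RadialLoewner.Disc.map_reflect_rotate hVc (-lam b) hx1, hx2,
        mul_eq_zero] at this
      rcases this with h | h
      · exact Complex.exp_ne_zero _ h
      · rw [map_eq_zero, mul_eq_zero] at h
        rcases h with h | h
        · exact hr0.ne' (by exact_mod_cast h)
        · exact Complex.exp_ne_zero _ h
    -- the point `z = Φ w` outside `K_s`
    set z := Φ w with hz
    have hzb : z ∉ C.hull b := C.invMap_inv_notMem_hull hlam hw0 hwball
    have hzc : (C.map b z)⁻¹ = w := C.invCoord_invMap_inv hlam hw0 hwball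
    have hzs : z ∉ C.hull (b + u) := by
      rw [← mem_compl_iff, C.compl_hull_add_eq hlam b u]
      exact ⟨hzb, hzc ▸ hw1⟩
    have hmap : C.map (b + u) z = (R : ℂ) * Complex.exp ((lam s : ℝ) * Complex.I) := by
      rw [C.map_add_eq hlam hzs, hzc, hw, shiftDriver_eq_incr, reflRot,
        RadialLoewner.Disc.map_reflect_rotate hVc (-lam b) hx1, hx2]
      rw [show Complex.exp (((-lam b : ℝ) : ℂ) * Complex.I) * (starRingEnd ℂ)
          ((((R⁻¹ : ℝ) : ℂ)) * Complex.exp ((V u : ℝ) * Complex.I)) =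
          reflRot lam b ((((R⁻¹ : ℝ) : ℂ)) * Complex.exp ((incr lam b u : ℝ) * Complex.I)) from rfl,
        reflRot_approach, hbu, mul_inv, ← Complex.exp_neg]
      congr 1
      · push_cast; rw [inv_inv]
      · push_cast; ring_nf
    rw [hbu] at hzs hmap
    rw [← hmap, C.invMap_map hlam hzs]
  -- the limit
  have hlim : Tendsto (fun R : ℝ ↦ Φ (reflRot lam b (x R⁻¹))) (𝓝[>] 1) (𝓝 (pieceCurve lam b η s)) := by
    have h1 : Tendsto (fun R : ℝ ↦ R⁻¹) (𝓝[>] (1 : ℝ)) (𝓝[<] (1 : ℝ)) := by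
      refine tendsto_nhdsWithin_iff.2 ⟨?_, ?_⟩
      · have := (continuousAt_inv₀ (one_ne_zero (α := ℝ))).tendsto
        rw [inv_one] at this
        exact this.mono_left nhdsWithin_le_nhds
      · filter_upwards [self_mem_nhdsWithin] with R hR using inv_lt_one_of_one_lt₀ (mem_Ioi.1 hR)
    have h2 : Tendsto (fun R : ℝ ↦ x R⁻¹) (𝓝[>] 1) (𝓝 (η u)) := (htip u hule).comp h1
    have h3 : Tendsto (fun R : ℝ ↦ reflRot lam b (x R⁻¹)) (𝓝[>] 1) (𝓝 (reflRot lam b (η u))) :=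
      ((continuous_reflRot lam b).tendsto _).comp h2
    have hmem : reflRot lam b (η u) ∈ ball (0 : ℂ) 1 \ {0} := reflRot_eta_mem hηlt hG hs
    have h4 : ContinuousAt Φ (reflRot lam b (η u)) :=
      (continuousOn_invMap_inv hlam).continuousAt
        ((isOpen_ball.sdiff isClosed_singleton).mem_nhds hmem)
    exact h4.tendsto.comp h3
  refine hlim.congr' ?_
  filter_upwards [self_mem_nhdsWithin] with R hR
  exact (key R (mem_Ioi.1 hR)).symm

end WithEta

end Piece

end WholePlaneLoewnerChain

end Literature.Probability.RandomPlanarGeometry
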